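import Mathlib.NumberTheory.NumberField.CMField
import HarnessLib

/-!
# A quadratic extension `F(√-n)` of a totally real field is a CM field

Topic `Literature/NumberTheory/NumberFields`; a *proofs* file (theorems only, no definitions, no
named facts).  If `F` is a totally real number field and `K ⊇ F` is a quadratic extension
containing a square root of a negative rational number (`x² = -n`, `n ≥ 1`), then `K` is totally
complex, hence `K/F` is a CM-extension and `K` is a CM field in the sense of Mathlib's
`NumberField.IsCMField` (`IsCMField.ofCMExtension`): Shimura, *Abelian varieties with complex
multiplication and modular functions* (1998), §18.2 (a CM field is a totally imaginary quadratic
extension of a totally real field); Milne, *Complex Multiplication* (2006), §1, Prop. 1.4.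
This is the bookkeeping behind the first reduction in Allen–Calegari–Caraiani–Gee–Helm–Le
Hung–Newton–Scholze–Taylor–Thorne, proof of Thm. 6.1.1 ("If `F` is totally real we first replace
`F` by a suitable imaginary CM quadratic extension", arXiv:1812.09999 p. 88: `F · E_a` with `E_a`
imaginary quadratic) — the hypothesis `IsTotallyReal E ∨ IsCMField E` of the tree's
`Literature.NumberTheory.Automorphic.ACC2023.solubleBaseChange_isAutomorphic` /
`solubleDescent_isAutomorphic` and of
`Literature.NumberTheory.Automorphic.ACCGHLNSTT2023.automorphyLifting_crystalline_weightZero` — and,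
with `finrank_adjoin_simple_eq_two_of_sq_eq`, the degree computation `[F(x) : F] = 2` for
`x ∉ F`, `x² ∈ F`.

## References

* G. Shimura, *Abelian Varieties with Complex Multiplication and Modular Functions*, Princeton
  1998, §18.2. [folklore]
* [ACCGHLNSTT2023] P. B. Allen et al., *Potential automorphy over CM fields*, Ann. of Math. 197
  (2023), §6.5, proof of Thm. 6.1.1 (p. 88 of arXiv:1812.09999).
-/

noncomputable section

open NumberField InfinitePlace Polynomial

namespace Literature.NumberTheory.NumberFields

/-! ## Totally complex fields from `x² = -n` -/

/-- **A field containing a square root of a negative rational number is totally complex**: if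
`x² = -n` with `n ≥ 1` then no embedding `K → ℂ` is real (`φ(x)² = -n < 0`). [folklore] -/
theorem isTotallyComplex_of_sq_eq_neg_natCast {K : Type*} [Field K] {x : K} {n : ℕ} (hn : 0 < n)
    (hx : x ^ 2 = -(n : K)) : IsTotallyComplex K := by
  refine ⟨fun w => ?_⟩
  rw [← not_isReal_iff_isComplex]
  intro hw
  rw [InfinitePlace.isReal_iff, ComplexEmbedding.isReal_iff] at hw
  set φ := w.embedding with hφ
  have hconj : starRingEnd ℂ (φ x) = φ x := by
    have h1 := RingHom.congr_fun hw x
    rwa [ComplexEmbedding.conjugate_coe_eq] at h1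
  have him : (φ x).im = 0 := Complex.conj_eq_iff_im.1 hconj
  have hsq : (φ x) ^ 2 = -(n : ℂ) := by rw [← map_pow, hx, map_neg, map_natCast]
  have hre : (φ x).re * (φ x).re = -(n : ℝ) := by
    have h1 := congrArg Complex.re hsq
    rw [sq, Complex.mul_re, him, mul_zero, sub_zero] at h1
    rw [h1, Complex.neg_re, Complex.natCast_re]
  have hpos : (0 : ℝ) < n := Nat.cast_pos.2 hn
  nlinarith [mul_self_nonneg ((φ x).re)]

/-! ## CM fields -/

/-- **A quadratic extension of a totally real field containing `√-n` is a CM field.**  Let `F`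
be totally real and `K ⊇ F` quadratic (`[K : F] = 2`) with `x ∈ K`, `x² = -n`, `n ≥ 1`
(e.g. `K = F · ℚ(√-n)`).  Then `K` is totally complex, so `K/F` is a CM-extension and `K` is CM
(Mathlib `IsCMField.ofCMExtension`; its maximal real subfield is `F`). [folklore] -/
theorem isCMField_of_isTotallyReal_of_sq_eq_neg_natCast (F K : Type*) [Field F] [IsTotallyReal F]
    [Field K] [CharZero K] [Algebra.IsIntegral ℚ K] [Algebra F K]
    [Algebra.IsQuadraticExtension F K] {x : K} {n : ℕ} (hn : 0 < n) (hx : x ^ 2 = -(n : K)) :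
    IsCMField K :=
  haveI := isTotallyComplex_of_sq_eq_neg_natCast hn hx
  IsCMField.ofCMExtension F K

/-- The same for number fields, from the numerical hypothesis `[K : F] = 2`. [folklore] -/
theorem isCMField_of_isTotallyReal_of_finrank_eq_two (F K : Type*) [Field F] [IsTotallyReal F]
    [Field K] [NumberField K] [Algebra F K] (h2 : Module.finrank F K = 2) {x : K} {n : ℕ}
    (hn : 0 < n) (hx : x ^ 2 = -(n : K)) : IsCMField K :=
  haveI : Algebra.IsQuadraticExtension F K := { finrank_eq_two' := h2 }
  isCMField_of_isTotallyReal_of_sq_eq_neg_natCast F K hn hx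

/-! ## The degree of `F(x)` with `x² ∈ F` -/

section Degree

variable {F L : Type*} [Field F] [Field L] [Algebra F L]

/-- **`[F(x) : F] = 2` for `x ∉ F` with `x² ∈ F`**: the minimal polynomial of `x` divides
`X² - a` and is not linear. [folklore] -/
theorem finrank_adjoin_simple_eq_two_of_sq_eq {x : L} {a : F} (hx : x ^ 2 = algebraMap F L a)
    (hxF : x ∉ Set.range (algebraMap F L)) :
    Module.finrank F (IntermediateField.adjoin F {x}) = 2 := by
  have hint : IsIntegral F x := by
    refine ⟨X ^ 2 - C a, monic_X_pow_sub_C a two_ne_zero, ?_⟩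
    simp [hx]
  rw [IntermediateField.adjoin.finrank hint]
  -- `minpoly F x ∣ X² - a`, so its degree is `≤ 2`; it is `≥ 2` since `x ∉ F`
  have hdvd : minpoly F x ∣ X ^ 2 - C a := by
    refine minpoly.dvd F x ?_
    simp [hx]
  have hle : (minpoly F x).natDegree ≤ 2 := by
    have h := natDegree_le_of_dvd hdvd (X_pow_sub_C_ne_zero two_pos a)
    rwa [natDegree_X_pow_sub_C] at h
  have hge : 2 ≤ (minpoly F x).natDegree := by
    rw [minpoly.two_le_natDegree_iff hint]
    intro hmem
    exact hxF (RingHom.mem_range.1 hmem)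
  exact le_antisymm hle hge

/-- **`F(x)` is a quadratic extension of `F`** for `x ∉ F` with `x² ∈ F`. [folklore] -/
theorem isQuadraticExtension_adjoin_simple_of_sq_eq {x : L} {a : F}
    (hx : x ^ 2 = algebraMap F L a) (hxF : x ∉ Set.range (algebraMap F L)) :
    Algebra.IsQuadraticExtension F (IntermediateField.adjoin F {x}) :=
  { finrank_eq_two' := finrank_adjoin_simple_eq_two_of_sq_eq hx hxF }

end Degree

/-- **`F(√-n)` is a CM field for `F` a totally real number field** (`√-n ∉ F`, `n ≥ 1`): the
first reduction of the proof of ACC+ Thm. 6.1.1 replaces a totally real `F` by such an imaginary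
CM quadratic extension `F · ℚ(√-n)`.  Here `L ⊇ F` is any field of characteristic `0` in which
`-n` has a square root `x ∉ F` (e.g. `L = F̄`), and `F(x) = IntermediateField.adjoin F {x}`.
[cite: ACCGHLNSTT2023, §6.5, proof of Thm. 6.1.1 (p. 88 of arXiv:1812.09999)] -/
theorem isCMField_adjoin_sqrt_neg {F L : Type*} [Field F] [NumberField F] [IsTotallyReal F]
    [Field L] [CharZero L] [Algebra F L] {x : L} {n : ℕ} (hn : 0 < n)
    (hx : x ^ 2 = -(n : L)) (hxF : x ∉ Set.range (algebraMap F L)) :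
    IsCMField (IntermediateField.adjoin F {x}) := by
  have hxa : x ^ 2 = algebraMap F L (-(n : F)) := by rw [hx, map_neg, map_natCast]
  have hint : IsIntegral F x :=
    ⟨X ^ 2 - C (-(n : F)), monic_X_pow_sub_C _ two_ne_zero, by simp [hxa]⟩
  haveI : FiniteDimensional F (IntermediateField.adjoin F {x}) :=
    IntermediateField.adjoin.finiteDimensional hint
  haveI : NumberField (IntermediateField.adjoin F {x}) :=
    NumberField.of_module_finite F (IntermediateField.adjoin F {x})
  set y : IntermediateField.adjoin F {x} := ⟨x, IntermediateField.mem_adjoin_simple_self F x⟩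
    with hy
  have hy2 : y ^ 2 = -(n : IntermediateField.adjoin F {x}) := Subtype.ext (by simp [hy, hx])
  exact isCMField_of_isTotallyReal_of_finrank_eq_two F (IntermediateField.adjoin F {x})
    (finrank_adjoin_simple_eq_two_of_sq_eq hxa hxF) hn hy2

end Literature.NumberTheory.NumberFields

end
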